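import Summits.BirchSwinnertonDyer.BirchSwinnertonDyer.Theorems.GenusKolyvaginAtTwoKramerParityOfTateQuadraticForms
import Summits.BirchSwinnertonDyer.BirchSwinnertonDyer.Theorems.SchneiderFreeAdditiveX3PoitouTateReciprocitySumHolds
import Summits.BirchSwinnertonDyer.Rank1Residual.GaloisImage.LocalEulerPoincareCharacteristicHolds
import Literature.NumberTheory.GaloisCohomology.PoitouTateNumberField
import HarnessLib

/-!
# Route `GenusKolyvaginAtTwo`, crux #2 `GenusPrimitiveSupplyAtTwo` (stmt-BirchSwinnertonDyer-22136):
# KRAMER PARITY VIA QUADRATIC SELMER STRUCTURES, part 4 — `MazurRubin2010.kramerParity K` from a Tate-quadratic-form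
# datum for THE CANONICAL invariant maps, every duality input DISCHARGED

Width seat `bsd-line-gk2-p4` g11 (cell `bsd-f1-sign2`); sequel of `…KramerParityOfTateQuadraticForms`. THEOREMS ONLY (no
definition, no named fact, no `sorry`); helper `--supports stmt-BirchSwinnertonDyer-22136`; no item is closed; BSD is not
proved by any of this.

* `sum_canonical_eq_zero_of_natural` — (Q3) for `q_v = can_v ∘ q̃_v` from ONE global map `Q` with `q̃_v ∘ loc_v = loc_v ∘ Q`
  (Tate's reciprocity `sumInvLocalizationEqZero_canonical_of_numberField`).
* **`kramerParity_of_tateQuadraticForms_canonical`** — as part 3's `kramerParity_of_tateQuadraticForms`, with the polarisation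
(Q1) stated for THE invariant maps `LocalInvariants.canonical K 2` of class field theory (for which the tree PROVES the Brauer
reciprocity `sumInvLocalizationEqZero_canonical_of_numberField`, the natural source of (Q3)), the Poitou–Tate family taken
from `poitouTate_selmerStructure_duality_real_holds` (Milne I Thm. 4.10 with real places; it agrees with the canonical family
at level `2`, part 2 `invWeilPairing_eq_canonical_two`) and Tate's local Euler characteristic from
`localEulerPoincareCharacteristic_holds` (Milne I Thm. 2.8). What remains displayed is exactly the Poonen–Rains content
(Q1)–(Q4) — the target of the lead's F2–F4. Honest framing: a CONDITIONAL reduction; crux 22136 stays OPEN; BSD is not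
proved by any of this.

References: [MazurRubin2010] Thm. 2.7 (arXiv:0904.3709 p. 7); [KlagsbrunMazurRubin2013] Thm. 3.9; [PoonenRains2012]
Prop. 4.9, Prop. 4.11, Thm. 4.14; [MilneADT2006] I Ex. 1.6 (c), Thm. 2.8, Thm. 4.10 (b).
-/

set_option linter.dupNamespace false -- tree convention: `Summit.BirchSwinnertonDyer.BirchSwinnertonDyer.Theorems` (summit = sub-problem)
set_option autoImplicit false

noncomputable section

open scoped Classical ContRepresentation

namespace Summit.BirchSwinnertonDyer.BirchSwinnertonDyer.Theorems.GenusKolyKramer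

open WeierstrassCurve Field NumberField IsDedekindDomain Function Module
open Literature.NumberTheory.EllipticCurves Literature.NumberTheory.GaloisRepresentations
open Literature.NumberTheory.GaloisRepresentations.DiscreteGaloisModule (SelmerStructure mu MuCarrier localTatePairingZMod tateDual)
open Literature.NumberTheory.GaloisCohomology
open Literature.LinearAlgebra.QuadraticForm
open Summit.BirchSwinnertonDyer.Rank1Residual
open Summit.BirchSwinnertonDyer.Rank1Residual.X11b.FiniteDuality
open Summit.BirchSwinnertonDyer.Rank1Residual.X11b.Relaxation
open Summit.BirchSwinnertonDyer.Rank1Residual.X11b.LocBridge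

section CanonicalKramer

variable {K : Type} [Field K] [NumberField K]

/-- **(Q3) from Brauer reciprocity.** If the local maps `q̃_v : H¹(K_v, E[2]) → H²(K_v, μ₂)` are the localisations of ONE
global map `Q : H¹(K, E[2]) → H²(K, μ₂)` (`q̃_v(loc_v c) = loc_v(Q c)`), then `q_v := can_v ∘ q̃_v` satisfies the reciprocity
(Q3): Tate's reciprocity law for the Brauer group, tree `sumInvLocalizationEqZero_canonical_of_numberField` (every number field).
This is the form in which Poonen–Rains Thm. 4.14 / KMR Def. 3.3 (iii) is obtained.
[cite: PoonenRains2012, Thm. 4.14] [cite: MilneADT2006, Ch. I, Thm. 4.10(b)] -/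
theorem sum_canonical_eq_zero_of_natural (W : WeierstrassCurve K)
    (Q : galoisCohomology (W.torsionGaloisModule ((2 : ℕ) : ℤ)) 1 → galoisCohomology (mu K 2) 2)
    (ql : ∀ v : Place K, galoisCohomology ((W.torsionGaloisModule ((2 : ℕ) : ℤ)).toLocal v) 1 →
      galoisCohomology ((mu K 2).toLocal v) 2)
    (hnat : ∀ v c, ql v (galoisCohomology.localization (W.torsionGaloisModule ((2 : ℕ) : ℤ)) v 1 c) =
      galoisCohomology.localization (mu K 2) v 2 (Q c))
    (c : galoisCohomology (W.torsionGaloisModule ((2 : ℕ) : ℤ)) 1) (S : Finset (Place K))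
    (hS : ∀ v ∉ S, LocalInvariants.canonical K 2 v
      (ql v (galoisCohomology.localization (W.torsionGaloisModule ((2 : ℕ) : ℤ)) v 1 c)) = 0) :
    ∑ v ∈ S, LocalInvariants.canonical K 2 v
      (ql v (galoisCohomology.localization (W.torsionGaloisModule ((2 : ℕ) : ℤ)) v 1 c)) = 0 := by
  haveI : NeZero (2 : ℕ) := ⟨two_ne_zero⟩
  simp only [hnat] at hS ⊢
  exact sumInvLocalizationEqZero_canonical_of_numberField K 2 (Q c) S hS

/-- **KRAMER'S PARITY FROM A TATE-QUADRATIC-FORM DATUM FOR THE CANONICAL INVARIANT MAPS — all duality inputs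
discharged.** As `kramerParity_of_tateQuadraticForms`, with the polarisation (Q1) stated for THE invariant maps
`LocalInvariants.canonical K 2` of class field theory (for which the tree PROVES the Brauer reciprocity
`sumInvLocalizationEqZero_canonical_of_numberField`, the natural source of (Q3)), and with the Poitou–Tate family
(`poitouTate_selmerStructure_duality_real_holds`, Milne I Thm. 4.10) and Tate's local Euler characteristic
(`localEulerPoincareCharacteristic_holds`, Milne I Thm. 2.8) fed by tree theorems. What remains displayed is exactly the
Poonen–Rains content (Q1)–(Q4). [cite: MazurRubin2010, Thm. 2.7] [cite: KlagsbrunMazurRubin2013, Thm. 3.9]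
[cite: PoonenRains2012, Prop. 4.9, Prop. 4.11 and Thm. 4.14] -/
theorem kramerParity_of_tateQuadraticForms_canonical
    (hq : ∀ (W : WeierstrassCurve K) [W.IsElliptic],
      ∃ (e : geomTorsion W ((2 : ℕ) : ℤ) → geomTorsion W ((2 : ℕ) : ℤ) → AlgebraicClosure K)
        (hμ : ∀ S T, e S T ^ 2 = 1)
        (hadd₁ : ∀ S₁ S₂ T, e (S₁ + S₂) T = e S₁ T * e S₂ T)
        (hadd₂ : ∀ S T₁ T₂, e S (T₁ + T₂) = e S T₁ * e S T₂)
        (hgal : ∀ (σ : absoluteGaloisGroup K) (S T : geomTorsion W ((2 : ℕ) : ℤ)), σ • e S T = e (σ • S) (σ • T))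
        (_halt : ∀ T, e T T = 1) (_hnondeg : ∀ T, (∀ S, e S T = 1) → T = 0)
        (q : ∀ v : Place K, galoisCohomology ((W.torsionGaloisModule ((2 : ℕ) : ℤ)).toLocal v) 1 → ZMod 2),
        (∀ v x y, q v (x + y) = q v x + q v y +
          invWeilPairing W 2 e hμ hadd₁ hadd₂ hgal (LocalInvariants.canonical K 2) v x y) ∧
        (∀ v, ∀ x ∈ W.kummerSelmerStructure ((2 : ℕ) : ℤ) v, q v x = 0) ∧
        (∀ (c : galoisCohomology (W.torsionGaloisModule ((2 : ℕ) : ℤ)) 1) (S : Finset (Place K)),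
          (∀ v ∉ S, q v (galoisCohomology.localization (W.torsionGaloisModule ((2 : ℕ) : ℤ)) v 1 c) = 0) →
            ∑ v ∈ S, q v (galoisCohomology.localization (W.torsionGaloisModule ((2 : ℕ) : ℤ)) v 1 c) = 0) ∧
        (∀ (d : K), (∀ x : K, x ^ 2 ≠ d) → ∀ (W' : WeierstrassCurve K) [W'.IsElliptic],
          (∃ C : VariableChange K, C • W' = W.quadraticTwist d) →
          ∀ (φ : (W'.torsionGaloisModule ((2 : ℕ) : ℤ)).toContRepresentation →ⁱL
              (W.torsionGaloisModule ((2 : ℕ) : ℤ)).toContRepresentation),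
            Function.Injective φ →
            (∀ φ' : (W'.torsionGaloisModule ((2 : ℕ) : ℤ)).toContRepresentation →ⁱL
                (W.torsionGaloisModule ((2 : ℕ) : ℤ)).toContRepresentation,
              Function.Injective φ' → ∀ a, φ' a = φ a) →
          ∀ (𝓐 : SelmerStructure (W.torsionGaloisModule ((2 : ℕ) : ℤ))),
            (∀ v, 𝓐 v = (W'.kummerSelmerStructure ((2 : ℕ) : ℤ) v).map
              (galoisCohomology.map (φ.restrictField (Place.Completion v)) 1)) →
            ∀ v, ∀ x ∈ 𝓐 v, q v x = 0)) :
    MazurRubin2010.kramerParity K := by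
  haveI : NeZero (2 : ℕ) := ⟨two_ne_zero⟩
  obtain ⟨inv, hperf, hsum, -, hcompl, hreal⟩ :=
    SchneiderFreeAdditiveX3.PoitouTateReduction.poitouTate_selmerStructure_duality_real_holds (K := K) 2
  have hEP : ∀ v : HeightOneSpectrum (𝓞 K), localEulerPoincareCharacteristic (v.adicCompletion K) := fun v ↦
    haveI : CharZero (v.adicCompletion K) := charZero_of_injective_algebraMap (algebraMap K _).injective
    localEulerPoincareCharacteristic_holds (v.adicCompletion K)
  refine kramerParity_of_tateQuadraticForms inv hperf hsum hcompl hreal hEP fun W _ => ?_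
  obtain ⟨e, hμ, hadd₁, hadd₂, hgal, halt, hnondeg, q, hpolar, hisoK, hrec, hisoA⟩ := hq W
  exact ⟨e, hμ, hadd₁, hadd₂, hgal, halt, hnondeg, q, fun v x y => by
    rw [hpolar, invWeilPairing_eq_canonical_two W e hμ hadd₁ hadd₂ hgal inv hperf hreal], hisoK, hrec, hisoA⟩

end CanonicalKramer


end Summit.BirchSwinnertonDyer.BirchSwinnertonDyer.Theorems.GenusKolyKramer

end
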